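import Summits.NavierStokesRegularity.NavierStokesRegularity.Theorems.RobustBlowupPortabilityDivFreeTruncationParametric
import HarnessLib

/-!
# Kernel tools for the collar estimate of the averaged solenoidal truncation
  (tools for item stmt-NavierStokesRegularity-2928, `RobustBlowupPortability.DivFreeTruncation`)

On `ℝ³ = EuclideanSpace ℝ (Fin 3)`. The corrector of the averaged truncation is a double parametric
integral `∫_{‖a‖ ≤ r} ∫₀¹ K(x, a, t)[V(t(x − a) + a)] dt da` (companion file `…Averaged`). Its collar
derivatives are estimated by splitting the ray parameter at `t = 5/8`:

* for `t ≥ 5/8` the point `t(x − a) + a` stays in the shell `ρ/2 ≤ ‖·‖ ≤ 2ρ` where the derivatives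
  of `V` are controlled (`norm_segment_ge`, `norm_segment_le`), and derivatives in `x` of
  `V(t(x − a) + a)` are those of `V` damped by `tᵏ` (`norm_iteratedFDeriv_comp_segment_le`);
* for `t ≤ 5/8` the substitution `b = (1 − t)a + tx` in the `a`-integral
  (`integral_eq_smul_integral_comp_subst`, Haar scaling and translation invariance) moves every
  `x`-derivative onto the (smooth, `V`-free) kernel; the factor `(1 − t)⁻¹` is replaced by a globally
  smooth function agreeing with it on `t ≤ 3/4` (`exists_smooth_inv_one_sub`), so that the tools of
  `…Parametric` (smooth integrands on the whole space) apply; the new variable stays in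
  `‖b‖ ≤ 3ρ/2` (`norm_subst_le`).

Also: iterated interval integrals over a compact box are product-set integrals
(`setIntegral_intervalIntegral_eq_setIntegral_prod`), the form in which `…Parametric` is applied.

HONEST FRAMING: calculus lemmas; nothing here bears on Navier–Stokes regularity.
-/

noncomputable section

set_option linter.dupNamespace false

namespace Summit.NavierStokesRegularity.NavierStokesRegularity.Theorems

open Set MeasureTheory Filter Topology Function ContinuousLinearMap Module Metric
open scoped ContDiff

namespace DivFreeTruncation

/-! ### A smooth replacement of `(1 - t)⁻¹` -/

/-- There is a smooth function `ι : ℝ → ℝ` agreeing with `(1 − t)⁻¹` for `t ≤ 3/4`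
(`smoothTransition (7 − 8t) · (1 − t)⁻¹`, which vanishes identically near and beyond `t = 1`).
[folklore] -/
theorem exists_smooth_inv_one_sub :
    ∃ ι : ℝ → ℝ, ContDiff ℝ ∞ ι ∧ ∀ t : ℝ, t ≤ 3 / 4 → ι t = (1 - t)⁻¹ := by
  refine ⟨fun t => Real.smoothTransition (7 - 8 * t) * (1 - t)⁻¹, ?_, ?_⟩
  · have hκ : ContDiff ℝ ∞ fun t : ℝ => Real.smoothTransition (7 - 8 * t) :=
      Real.smoothTransition.contDiff.comp (contDiff_const.sub (contDiff_const.mul contDiff_id))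
    refine contDiff_iff_contDiffAt.2 fun t => ?_
    by_cases ht : t < 1
    · have h1 : ContDiffAt ℝ ∞ (fun s : ℝ => (1 - s)⁻¹) t := by
        have hne : (1 - t) ≠ 0 := by linarith
        exact (contDiffAt_const.sub contDiffAt_id).inv hne
      exact hκ.contDiffAt.mul h1
    · have hopen : IsOpen {s : ℝ | 7 / 8 < s} := isOpen_lt continuous_const continuous_id
      have hmem : t ∈ {s : ℝ | 7 / 8 < s} := by
        show 7 / 8 < t; linarith
      have hloc : (fun s => Real.smoothTransition (7 - 8 * s) * (1 - s)⁻¹) =ᶠ[𝓝 t]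
          fun _ => (0 : ℝ) := by
        filter_upwards [hopen.mem_nhds hmem] with s hs
        have hs' : 7 / 8 < s := hs
        have : Real.smoothTransition (7 - 8 * s) = 0 :=
          Real.smoothTransition.zero_of_nonpos (by linarith)
        simp [this]
      exact (contDiffAt_const (c := (0 : ℝ))).congr_of_eventuallyEq hloc
  · intro t ht
    have : Real.smoothTransition (7 - 8 * t) = 1 :=
      Real.smoothTransition.one_of_one_le (by linarith)
    simp [this]

/-! ### Iterated interval integrals as product-set integrals -/

/-- An iterated integral `∫_{a ∈ S} ∫_{t₁}^{t₂}` of a continuous integrand over a compact `S` is the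
integral over the compact product set `S × [t₁, t₂]` for the product (volume) measure. [folklore] -/
theorem setIntegral_intervalIntegral_eq_setIntegral_prod {G : Type*} [NormedAddCommGroup G]
    [NormedSpace ℝ G] {F : EuclideanSpace ℝ (Fin 3) × ℝ → G} (hF : Continuous F)
    {S : Set (EuclideanSpace ℝ (Fin 3))} (hS : IsCompact S) {t₁ t₂ : ℝ} (ht : t₁ ≤ t₂) :
    ∫ a in S, ∫ t in t₁..t₂, F (a, t) = ∫ p in S ×ˢ Icc t₁ t₂, F p := by
  have hInt : IntegrableOn F (S ×ˢ Icc t₁ t₂) ((volume : Measure (EuclideanSpace ℝ (Fin 3))).prod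
      (volume : Measure ℝ)) :=
    hF.continuousOn.integrableOn_compact (hS.prod isCompact_Icc)
  rw [Measure.volume_eq_prod, setIntegral_prod F hInt]
  simp_rw [intervalIntegral.integral_of_le ht, ← integral_Icc_eq_integral_Ioc]

/-! ### The substitution `b = (1 - t) a + t x` -/

/-- Haar scaling and translation invariance in dimension `3`: for `t < 1`,
`∫ φ(a) da = (1 − t)⁻³ ∫ φ((1 − t)⁻¹(b − t x)) db`. [folklore] -/
theorem integral_eq_smul_integral_comp_subst {G : Type*} [NormedAddCommGroup G] [NormedSpace ℝ G]
    (φ : EuclideanSpace ℝ (Fin 3) → G) {t : ℝ} (ht : t < 1) (x : EuclideanSpace ℝ (Fin 3)) :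
    ∫ a, φ a = ((1 - t) ^ 3)⁻¹ • ∫ b, φ ((1 - t)⁻¹ • (b - t • x)) := by
  have h1 : ∫ b, φ ((1 - t)⁻¹ • (b - t • x)) = ∫ b, φ ((1 - t)⁻¹ • b) :=
    integral_sub_right_eq_self (fun b => φ ((1 - t)⁻¹ • b)) (t • x)
  have h2 : ∫ b, φ ((1 - t)⁻¹ • b) = |(((1 - t)⁻¹) ^ finrank ℝ (EuclideanSpace ℝ (Fin 3)))⁻¹| •
      ∫ a, φ a := Measure.integral_comp_smul volume φ (1 - t)⁻¹
  rw [h1, h2, finrank_euclideanSpace_fin, smul_smul]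
  have hpos : 0 < 1 - t := by linarith
  have h3 : ((1 - t) ^ 3)⁻¹ * |(((1 - t)⁻¹) ^ 3)⁻¹| = 1 := by
    rw [inv_pow, inv_inv, abs_of_pos (pow_pos hpos 3), inv_mul_cancel₀ (pow_pos hpos 3).ne']
  rw [h3, one_smul]

/-- The substituted centre lies on the right segment: with `a = (1 − t)⁻¹(b − t x)` one has
`t(x − a) + a = b` (`t ≠ 1`). [folklore] -/
theorem segment_subst_eq {t : ℝ} (ht : t ≠ 1) (x b : EuclideanSpace ℝ (Fin 3)) :
    t • (x - (1 - t)⁻¹ • (b - t • x)) + (1 - t)⁻¹ • (b - t • x) = b := by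
  have h : (1 - t) ≠ 0 := sub_ne_zero.2 (Ne.symm ht)
  have key : t • (x - (1 - t)⁻¹ • (b - t • x)) + (1 - t)⁻¹ • (b - t • x) =
      t • x + (1 - t) • ((1 - t)⁻¹ • (b - t • x)) := by
    rw [smul_sub, sub_smul, one_smul]; abel
  rw [key, smul_smul, mul_inv_cancel₀ h, one_smul]
  abel

/-- The segment point written affinely: `t(x − a) + a = t x + (1 − t) a`. [folklore] -/
theorem segment_eq_affine (t : ℝ) (x a : EuclideanSpace ℝ (Fin 3)) :
    t • (x - a) + a = t • x + (1 - t) • a := by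
  rw [smul_sub, sub_smul, one_smul]; abel

/-! ### Derivatives of `x ↦ V(t(x − a) + a)` -/

/-- **Chain rule along the segment**: for `|t| ≤ 1`,
`‖Dᵏ[V(t(· − a) + a)](x)‖ ≤ ‖DᵏV(t(x − a) + a)‖` (composition with the affine map `y ↦ ty + (a − ta)`
of linear part `t·id`, `‖t·id‖ ≤ 1`). [folklore] -/
theorem norm_iteratedFDeriv_comp_segment_le {G : Type*} [NormedAddCommGroup G] [NormedSpace ℝ G]
    {V : EuclideanSpace ℝ (Fin 3) → G} (hV : ContDiff ℝ ∞ V) {t : ℝ} (ht : |t| ≤ 1)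
    (a x : EuclideanSpace ℝ (Fin 3)) (k : ℕ) :
    ‖iteratedFDeriv ℝ k (fun y => V (t • (y - a) + a)) x‖ ≤
      ‖iteratedFDeriv ℝ k V (t • (x - a) + a)‖ := by
  have hrepr : (fun y : EuclideanSpace ℝ (Fin 3) => V (t • (y - a) + a)) =
      (fun z => V (z + (a - t • a))) ∘
        (t • ContinuousLinearMap.id ℝ (EuclideanSpace ℝ (Fin 3))) := by
    funext y
    simp only [comp_apply, _root_.FunLike.coe_smul, Pi.smul_apply,
      ContinuousLinearMap.id_apply, smul_sub]
    congr 1; abel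
  have hVc : ContDiff ℝ ∞ fun z : EuclideanSpace ℝ (Fin 3) => V (z + (a - t • a)) :=
    hV.comp (contDiff_id.add contDiff_const)
  rw [hrepr, ContinuousLinearMap.iteratedFDeriv_comp_right _ hVc x (by exact_mod_cast le_top),
    iteratedFDeriv_comp_add_right]
  have hpt : (t • ContinuousLinearMap.id ℝ (EuclideanSpace ℝ (Fin 3))) x + (a - t • a) =
      t • (x - a) + a := by
    simp only [_root_.FunLike.coe_smul, Pi.smul_apply, ContinuousLinearMap.id_apply, smul_sub]
    abel
  rw [hpt]
  refine (ContinuousMultilinearMap.norm_compContinuousLinearMap_le _ _).trans ?_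
  have hle : ‖t • ContinuousLinearMap.id ℝ (EuclideanSpace ℝ (Fin 3))‖ ≤ 1 := by
    refine (norm_smul_le t (ContinuousLinearMap.id ℝ (EuclideanSpace ℝ (Fin 3)))).trans ?_
    rw [Real.norm_eq_abs]
    exact mul_le_one₀ ht (norm_nonneg _) ContinuousLinearMap.norm_id_le
  have hprod : ∏ _i : Fin k, ‖t • ContinuousLinearMap.id ℝ (EuclideanSpace ℝ (Fin 3))‖ ≤ 1 :=
    Finset.prod_le_one (fun _ _ => norm_nonneg _) fun _ _ => hle
  calc ‖iteratedFDeriv ℝ k V (t • (x - a) + a)‖ *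
        ∏ _i : Fin k, ‖t • ContinuousLinearMap.id ℝ (EuclideanSpace ℝ (Fin 3))‖
      ≤ ‖iteratedFDeriv ℝ k V (t • (x - a) + a)‖ * 1 := by gcongr
    _ = _ := mul_one _

/-! ### Segment geometry -/

/-- For centres `‖a‖ ≤ ρ/16`, collar points `15ρ/16 ≤ ‖x‖` and `5/8 ≤ t ≤ 1` the segment point
`t(x − a) + a` has norm `≥ ρ/2`. [folklore] -/
theorem norm_segment_ge {ρ t : ℝ} {x a : EuclideanSpace ℝ (Fin 3)} (ha : ‖a‖ ≤ ρ / 16)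
    (hx : 15 * ρ / 16 ≤ ‖x‖) (ht : 5 / 8 ≤ t) (ht1 : t ≤ 1) : ρ / 2 ≤ ‖t • (x - a) + a‖ := by
  rw [segment_eq_affine]
  have h1 : ‖t • x‖ = t * ‖x‖ := by rw [norm_smul, Real.norm_of_nonneg (by linarith)]
  have h2 : ‖(1 - t) • a‖ = (1 - t) * ‖a‖ := by rw [norm_smul, Real.norm_of_nonneg (by linarith)]
  have h3 : ‖t • x‖ ≤ ‖t • x + (1 - t) • a‖ + ‖(1 - t) • a‖ := by
    have := norm_le_insert' (t • x) (t • x + (1 - t) • a)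
    have h4 : t • x - (t • x + (1 - t) • a) = -((1 - t) • a) := by abel
    rwa [h4, norm_neg] at this
  have hρ : 0 ≤ ρ := by linarith [norm_nonneg a]
  nlinarith [norm_nonneg x, norm_nonneg a]

/-- For centres `‖a‖ ≤ ρ/16`, points `‖x‖ ≤ 2ρ` and `0 ≤ t ≤ 1` the segment point has norm `≤ 2ρ`.
[folklore] -/
theorem norm_segment_le {ρ t : ℝ} {x a : EuclideanSpace ℝ (Fin 3)} (ha : ‖a‖ ≤ ρ / 16)
    (hx : ‖x‖ ≤ 2 * ρ) (ht : 0 ≤ t) (ht1 : t ≤ 1) : ‖t • (x - a) + a‖ ≤ 2 * ρ := by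
  rw [segment_eq_affine]
  have h1 : ‖t • x‖ = t * ‖x‖ := by rw [norm_smul, Real.norm_of_nonneg ht]
  have h2 : ‖(1 - t) • a‖ = (1 - t) * ‖a‖ := by rw [norm_smul, Real.norm_of_nonneg (by linarith)]
  have h3 := norm_add_le (t • x) ((1 - t) • a)
  have hρ : 0 ≤ ρ := by linarith [norm_nonneg a]
  nlinarith [norm_nonneg x, norm_nonneg a]

/-- Range of the substituted variable: if the substituted centre `(1 − t)⁻¹(b − t x)` has norm
`≤ ρ/16`, `‖x‖ ≤ 2ρ` and `0 ≤ t ≤ 5/8`, then `‖b‖ ≤ 3ρ/2`. [folklore] -/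
theorem norm_subst_le {ρ t : ℝ} {x b : EuclideanSpace ℝ (Fin 3)}
    (hb : ‖(1 - t)⁻¹ • (b - t • x)‖ ≤ ρ / 16) (hx : ‖x‖ ≤ 2 * ρ) (ht : 0 ≤ t) (ht1 : t ≤ 5 / 8) :
    ‖b‖ ≤ 3 * ρ / 2 := by
  have hne : t ≠ 1 := by linarith
  have hb_eq : b = t • x + (1 - t) • ((1 - t)⁻¹ • (b - t • x)) := by
    conv_lhs => rw [← segment_subst_eq hne x b]
    rw [segment_eq_affine]
  have h1 : ‖t • x‖ = t * ‖x‖ := by rw [norm_smul, Real.norm_of_nonneg ht]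
  have h2 : ‖(1 - t) • ((1 - t)⁻¹ • (b - t • x))‖ = (1 - t) * ‖(1 - t)⁻¹ • (b - t • x)‖ := by
    rw [norm_smul, Real.norm_of_nonneg (by linarith)]
  have h3 := norm_add_le (t • x) ((1 - t) • ((1 - t)⁻¹ • (b - t • x)))
  rw [← hb_eq] at h3
  have hρ : 0 ≤ ρ := by linarith [norm_nonneg ((1 - t)⁻¹ • (b - t • x))]
  nlinarith [norm_nonneg x, norm_nonneg ((1 - t)⁻¹ • (b - t • x))]

end DivFreeTruncation

end Summit.NavierStokesRegularity.NavierStokesRegularity.Theorems
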